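import Summits.HodgeConjecture.HodgeConjecture.Theorems.Ring2AbelianAllAndreTwistedProductPlanes
import HarnessLib

/-!
# Ring 2 · AbelianAll — ANDRÉ AXIS, PART XLIX-c: FOR THE PRODUCT POLARISATIONS, «SPLIT TWISTED PRODUCT» ⟺ «ISODISCRIMINANTAL»
  (the converse of ab-weil-1's `isSplitWeilType_twistedProd_of_class_eq` at the Segre class; AV level, fact-free)

HONEST FRAMING (sub-cell `pub-hodge-ring2-ab-*`, verbatim): research route, not a corollary; conditional on HC_CM plus
one named minimal statement. (Cell `pub-hodge-ring2`, verbatim: research route conditional on HC_CM; not a corollary;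
Q11.4-sentence-2 already refuted in dim ≥ 3.) `HC_CM` does not occur in this file. No definition, no named fact, no
`sorry`; no node is used — pure (bi)linear algebra on the carriers plus the tree's PROVED van Geemen / Landherr layer.

CONTEXT. Part XLIX-b's minimal binder for the twisted-product rows is «the conjugate-twisted products `(A_s × A_t, φ_s × (−φ_t))`
are of SPLIT Weil type for uncountably many `s`», discharged there from «isodiscriminantal» (ab-weil-1 g108 + part XLIX-a).
This file answers the referee's natural question "is isodiscriminantal the right binder?" at the level of the PRODUCT
POLARISATIONS: for two pairs `(A, φ)`, `(B, ψ)` of `K`-rank `2n` with `K`-symmetrised hyperplane classes `h_A`, `h_B` of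
non-degenerate classes `δ_A`, `δ_B`, and the Segre embedding `e` of `A × B` with `e^*a = pr_A^*(e_A^*a_A) + c·pr_B^*(e_B^*a_B)`
(ab-weil-2's `exists_segreEmbedding_prod_of_classes`), the `K`-symmetrisation of `e^*a` for the TWISTED structure
`Φ = φ × (−ψ)` is `pr_A^*h_A + pr_B^*(c·h_B)` (`(−ψ)^* = ψ^*` on `H²`), its discriminant class is `δ_A · δ_B` (ab-weil-1's
`hasWeilDiscriminantNondeg_twistedProd`), and the class of a `K`-symmetrised hyperplane class is UNIQUE and equals `[(−1)^N]`
when hyperbolic (`VanGeemen1994.hasWeilDiscriminantNondeg_ksymm_unique`, `…_neg_one_pow_of_isHyperbolicWeilType`). Hence: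

* §1 `ksymm_segre_twistedProd` — the `K`-symmetrisation identity for `Φ = φ × (−ψ)`;
  `hasWeilDiscriminantNondeg_twistedProd_segre` — the twisted product carries the class `δ_A · δ_B` AT the `K`-symmetrised
  Segre class (top powers non-zero by `VanGeemen1994.prod_kFrames_top_ne_zero`).
* §2 **`class_eq_of_isHyperbolicWeilType_twistedProd_segre`** — if `(A × B, φ × (−ψ))` is HYPERBOLIC for the
  `K`-symmetrised Segre class, then `δ_A = δ_B` (`δ_A δ_B = [(−1)^{2n}] = 1` and every class is `2`-torsion);
  **`isHyperbolicWeilType_twistedProd_segre_iff_class_eq`** — for `(A, φ)`, `(B, ψ)` of Weil type `(n, n)`: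
  hyperbolic at the Segre class ⟺ `δ_A = δ_B` (⟸: ab-weil-1's class + Landherr's converse on the carriers).

So «isodiscriminantal» is EXACTLY «the product polarisation of `X_s × X̄_t` is hyperbolic»; part XLIX-b's binder
`IsSplitWeilType` (SOME `K`-symmetrised hyperplane class hyperbolic) is implied by it and is a priori weaker (other
polarisations of the product are not controlled here). No case of the Hodge conjecture is claimed; N104 untouched.

## References

* [vanGeemen1994HodgeAV] B. van Geemen, LNM 1594 (1994), 4.14, Lemma 5.2 (2)–(4), 5.4 and (5.4.1).
* [Landherr1936HermitianForms] W. Landherr, Abh. Math. Sem. Hamburg 11 (1936) 245–248.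
* [Hartshorne1977] R. Hartshorne, Algebraic Geometry, II Ex. 5.11–5.12 (Segre embedding, `𝒪(1,1)`).
* [Markman2025SurveySecant] E. Markman, arXiv:2509.23403, §11.5 Step 2 (product polarisations; preprint, unrefereed).
-/

set_option linter.dupNamespace false

noncomputable section

open CategoryTheory

namespace Summit.HodgeConjecture.HodgeConjecture.Ring2.AbelianAll

open Literature.AlgebraicGeometry Literature.AlgebraicGeometry.Motives
open Literature.AlgebraicGeometry.HodgeTheory Literature.AlgebraicGeometry.VanGeemen1994
open Literature.AlgebraicTopology.SingularHomology
open Literature.Geometry.Kaehler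
open Summit.HodgeConjecture.HodgeConjecture.WeilTypeLadder
open Summit.HodgeConjecture.HodgeConjecture.Theses
open Summit.HodgeConjecture.HodgeConjecture.Ring2.Hypotheses

variable {A B : AbelianVariety ℂ} {φ : A ⟶ A} {ψ : B ⟶ B} {n d : ℕ}

/-! ## §1 The `K`-symmetrised Segre class of the twisted product and its discriminant class -/

/-- **`K`-symmetrisation of the Segre class for the TWISTED structure.** If `e^*a = pr_A^*(e_A^*a_A) + c·pr_B^*(e_B^*a_B)` then
`d·e^*a + (φ × (−ψ))^*e^*a = pr_A^* h_A + pr_B^*(c·h_B)` with `h_A = d·e_A^*a_A + φ^*e_A^*a_A`, `h_B = d·e_B^*a_B + ψ^*e_B^*a_B`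
(`(φ × (−ψ))^* pr_A^* = pr_A^* φ^*`, `(φ × (−ψ))^* pr_B^* = pr_B^* (−ψ)^*`, and `(−ψ)^* = ψ^*` on `H²`, `map_neg_two`).
[cite: Hartshorne1977, II Ex. 5.11 and Ex. 5.12] [cite: vanGeemen1994HodgeAV, Lemma 5.2 (1)] -/
theorem ksymm_segre_twistedProd (eA : ProjectiveEmbedding A.X) (aA : complexBetti (projectiveSpace eA.n ℂ) 2)
    (eB : ProjectiveEmbedding B.X) (aB : complexBetti (projectiveSpace eB.n ℂ) 2)
    (e : ProjectiveEmbedding (A.prod B).X) (a : complexBetti (projectiveSpace e.n ℂ) 2) (c : ℚ)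
    (he : complexBetti.map e.ι 2 a =
      complexBetti.map (AbelianVariety.fst A B).hom.hom.hom 2 (complexBetti.map eA.ι 2 aA) +
        ((c : ℚ) : ℂ) • complexBetti.map (AbelianVariety.snd A B).hom.hom.hom 2 (complexBetti.map eB.ι 2 aB)) :
    (d : ℂ) • complexBetti.map e.ι 2 a +
        complexBetti.map (AbelianVariety.prodLift (AbelianVariety.fst A B ≫ φ)
          (AbelianVariety.snd A B ≫ (-ψ))).hom.hom.hom 2 (complexBetti.map e.ι 2 a) =
      complexBetti.map (AbelianVariety.fst A B).hom.hom.hom 2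
          ((d : ℂ) • complexBetti.map eA.ι 2 aA + complexBetti.map φ.hom.hom.hom 2 (complexBetti.map eA.ι 2 aA)) +
        complexBetti.map (AbelianVariety.snd A B).hom.hom.hom 2
          (((c : ℚ) : ℂ) • ((d : ℂ) • complexBetti.map eB.ι 2 aB +
            complexBetti.map ψ.hom.hom.hom 2 (complexBetti.map eB.ι 2 aB))) := by
  rw [he, map_add, map_smul, map_prodLift_map_fst φ (-ψ) 2, map_prodLift_map_snd φ (-ψ) 2, map_neg_two]
  simp only [map_add, map_smul, smul_add, smul_smul]
  rw [mul_comm ((c : ℚ) : ℂ) (d : ℂ)]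
  abel

/-- **The twisted product carries the class `δ_A · δ_B` AT the `K`-symmetrised Segre class.** Setting: `dim A = dim B = 2n`
(`n ≥ 1`), `φ² = ψ² = −d` (`d ≥ 1`), `K`-symmetrised hyperplane classes `h_A`, `h_B` of `(A, φ, e_A, a_A)`, `(B, ψ, e_B, a_B)`
with non-degenerate classes `δ_A`, `δ_B`, and Segre data `(e, a, c)`, `a ≠ 0` rational, `c ∈ ℚ^×`. The top powers of `h_A` and
`c·h_B` are non-zero (`prod_kFrames_top_ne_zero`, read for the pair `(φ, −ψ)`), so ab-weil-1's `hasWeilDiscriminantNondeg_twistedProd`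
applies and §1's identity moves its class to the Segre form. [cite: vanGeemen1994HodgeAV, Lemma 5.2 (2)–(3)]
[cite: Markman2025SurveySecant, §11.5 Step 2] -/
theorem hasWeilDiscriminantNondeg_twistedProd_segre (hn : 0 < n) (hd : 0 < d) (hA : A.dim = 2 * n) (hB : B.dim = 2 * n)
    (hφ : φ ≫ φ = -(d • 𝟙 A)) (hψ : ψ ≫ ψ = -(d • 𝟙 B))
    (eA : ProjectiveEmbedding A.X) {aA : complexBetti (projectiveSpace eA.n ℂ) 2} (haA : IsRationalClass aA)
    (eB : ProjectiveEmbedding B.X) {aB : complexBetti (projectiveSpace eB.n ℂ) 2} (haB : IsRationalClass aB)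
    {δA δB : weilNormResidueGroup d}
    (hWA : HasWeilDiscriminantNondeg A φ n d
      ((d : ℂ) • complexBetti.map eA.ι 2 aA + complexBetti.map φ.hom.hom.hom 2 (complexBetti.map eA.ι 2 aA)) δA)
    (hWB : HasWeilDiscriminantNondeg B ψ n d
      ((d : ℂ) • complexBetti.map eB.ι 2 aB + complexBetti.map ψ.hom.hom.hom 2 (complexBetti.map eB.ι 2 aB)) δB)
    (e : ProjectiveEmbedding (A.prod B).X) {a : complexBetti (projectiveSpace e.n ℂ) 2} (ha : IsRationalClass a)
    (ha0 : a ≠ 0) {c : ℚ} (hc0 : c ≠ 0)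
    (he : complexBetti.map e.ι 2 a =
      complexBetti.map (AbelianVariety.fst A B).hom.hom.hom 2 (complexBetti.map eA.ι 2 aA) +
        ((c : ℚ) : ℂ) • complexBetti.map (AbelianVariety.snd A B).hom.hom.hom 2 (complexBetti.map eB.ι 2 aB)) :
    HasWeilDiscriminantNondeg (A.prod B)
      (AbelianVariety.prodLift (AbelianVariety.fst A B ≫ φ) (AbelianVariety.snd A B ≫ (-ψ))) (n + n) d
      ((d : ℂ) • complexBetti.map e.ι 2 a +
        complexBetti.map (AbelianVariety.prodLift (AbelianVariety.fst A B ≫ φ)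
          (AbelianVariety.snd A B ≫ (-ψ))).hom.hom.hom 2 (complexBetti.map e.ι 2 a)) (δA * δB) := by
  classical
  set hKA := (d : ℂ) • complexBetti.map eA.ι 2 aA + complexBetti.map φ.hom.hom.hom 2 (complexBetti.map eA.ι 2 aA)
    with hKAdef
  set hKB := (d : ℂ) • complexBetti.map eB.ι 2 aB + complexBetti.map ψ.hom.hom.hom 2 (complexBetti.map eB.ι 2 aB)
    with hKBdef
  have hh := ksymm_segre_twistedProd (φ := φ) (ψ := ψ) (d := d) eA aA eB aB e a c he
  rw [← hKAdef, ← hKBdef] at hh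
  have hψ' : (-ψ) ≫ (-ψ) = -(d • 𝟙 B) := by rw [Preadditive.neg_comp, Preadditive.comp_neg, neg_neg, hψ]
  -- `c · h_B` has the class of `h_B`, also for `-ψ`; rationality
  have hWB' : HasWeilDiscriminantNondeg B ψ n d (((c : ℚ) : ℂ) • hKB) δB :=
    (hasWeilDiscriminantNondeg_ratCast_smul_iff hc0).2 hWB
  have hWBneg : HasWeilDiscriminantNondeg B (-ψ) n d (((c : ℚ) : ℂ) • hKB) δB := hasWeilDiscriminantNondeg_neg hWB'
  have hrA : IsRationalClass hKA := isRationalClass_ksymm d φ eA haA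
  have hrB' : IsRationalClass (((c : ℚ) : ℂ) • hKB) := (isRationalClass_ksymm d ψ eB haB).smul c
  -- the top self-intersections of `h_A`, `c · h_B` do not vanish
  have hAdim : A.dim = 2 * n - 1 + 1 := by omega
  have hBdim : B.dim = 2 * n - 1 + 1 := by omega
  have hXA : IsSmoothProjective (2 * n - 1 + 1) A.X := isSmoothProjective_of_dim_eq' hAdim
  have hXB : IsSmoothProjective (2 * n - 1 + 1) B.X := isSmoothProjective_of_dim_eq' hBdim
  obtain ⟨xA, ωA, amA, bmA, qA, hxA, hiA, hωA, hωA0, hQA, -, -⟩ := id hWA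
  obtain ⟨xB, ωB, amB, bmB, qB, hxB, hiB, hωB, hωB0, hQB, -, -⟩ := id hWBneg
  obtain ⟨dA, hdA⟩ := exists_eq_ratCast_smul_of_finrank_eq_one
    (Motives.finrank_complexBetti_two_add_two_mul_eq_one hXA) hωA hωA0
    (HodgeRiemannDegreeOne.IsRationalClass.lefschetzPow hrA (2 * n - 1) hrA)
  obtain ⟨dB, hdB⟩ := exists_eq_ratCast_smul_of_finrank_eq_one
    (Motives.finrank_complexBetti_two_add_two_mul_eq_one hXB) hωB hωB0
    (HodgeRiemannDegreeOne.IsRationalClass.lefschetzPow hrB' (2 * n - 1) hrB')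
  obtain ⟨hdA0, hdB0⟩ := prod_kFrames_top_ne_zero (N := n + n) hAdim hBdim (by omega) (by omega) (by omega)
    (by omega) hd hφ hψ' xA hxA hiA hKA ωA amA bmA hQA dA hdA xB hxB hiB _ ωB amB bmB hQB dB hdB e ha ha0 hh
  have htA : lefschetzPow hKA (2 * n - 1) 2 hKA ≠ 0 := by
    rw [hdA]; exact smul_ne_zero (by exact_mod_cast hdA0) hωA0
  have htB : lefschetzPow (((c : ℚ) : ℂ) • hKB) (2 * n - 1) 2 (((c : ℚ) : ℂ) • hKB) ≠ 0 := by
    rw [hdB]; exact smul_ne_zero (by exact_mod_cast hdB0) hωB0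
  -- "det H is multiplicative" for the twisted product (ab-weil-1), then move to the Segre form
  obtain ⟨hprod, -⟩ := hasWeilDiscriminantNondeg_twistedProd hn hn hA hB hrA hrB' htA htB hWA hWB'
  rw [← hh] at hprod
  exact hprod

/-! ## §2 Hyperbolic at the Segre class ⟺ isodiscriminantal -/

/-- Every class of `ℚˣ/Nm(K_dˣ)` is `2`-torsion, so `δ_A · δ_B = 1 ⟹ δ_A = δ_B`. [cite: vanGeemen1994HodgeAV, 4.14] -/
theorem eq_of_mul_eq_one_weilNormResidueGroup {δA δB : weilNormResidueGroup d} (h : δA * δB = 1) : δA = δB := by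
  have h2 : δA = δA * (δB * δB) := by rw [weilNormResidueGroup_mul_self, mul_one]
  rw [h2, ← mul_assoc, h, one_mul]

/-- **HYPERBOLIC AT THE SEGRE CLASS ⟹ ISODISCRIMINANTAL.** In the setting of `hasWeilDiscriminantNondeg_twistedProd_segre`:
if the twisted product `(A × B, φ × (−ψ))` is of HYPERBOLIC Weil type in half-dimension `2n` for the `K`-symmetrised Segre
class `d·e^*a + (φ × (−ψ))^*e^*a`, then `δ_A = δ_B`. Proof: that class carries `δ_A · δ_B` (§1) and, being hyperbolic,
`[(−1)^{2n}] = 1` (`hasWeilDiscriminantNondeg_neg_one_pow_of_isHyperbolicWeilType`); the class of a `K`-symmetrised hyperplane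
class is unique (`hasWeilDiscriminantNondeg_ksymm_unique`); `2`-torsion. [cite: vanGeemen1994HodgeAV, Lemma 5.2 (3), 5.4 and (5.4.1)]
[cite: Landherr1936HermitianForms] -/
theorem class_eq_of_isHyperbolicWeilType_twistedProd_segre (hn : 0 < n) (hd : 0 < d) (hA : A.dim = 2 * n)
    (hB : B.dim = 2 * n) (hφ : φ ≫ φ = -(d • 𝟙 A)) (hψ : ψ ≫ ψ = -(d • 𝟙 B))
    (eA : ProjectiveEmbedding A.X) {aA : complexBetti (projectiveSpace eA.n ℂ) 2} (haA : IsRationalClass aA)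
    (eB : ProjectiveEmbedding B.X) {aB : complexBetti (projectiveSpace eB.n ℂ) 2} (haB : IsRationalClass aB)
    {δA δB : weilNormResidueGroup d}
    (hWA : HasWeilDiscriminantNondeg A φ n d
      ((d : ℂ) • complexBetti.map eA.ι 2 aA + complexBetti.map φ.hom.hom.hom 2 (complexBetti.map eA.ι 2 aA)) δA)
    (hWB : HasWeilDiscriminantNondeg B ψ n d
      ((d : ℂ) • complexBetti.map eB.ι 2 aB + complexBetti.map ψ.hom.hom.hom 2 (complexBetti.map eB.ι 2 aB)) δB)
    (e : ProjectiveEmbedding (A.prod B).X) {a : complexBetti (projectiveSpace e.n ℂ) 2} (ha : IsRationalClass a)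
    (ha0 : a ≠ 0) {c : ℚ} (hc0 : c ≠ 0)
    (he : complexBetti.map e.ι 2 a =
      complexBetti.map (AbelianVariety.fst A B).hom.hom.hom 2 (complexBetti.map eA.ι 2 aA) +
        ((c : ℚ) : ℂ) • complexBetti.map (AbelianVariety.snd A B).hom.hom.hom 2 (complexBetti.map eB.ι 2 aB))
    (hhyp : IsHyperbolicWeilType (A.prod B)
      (AbelianVariety.prodLift (AbelianVariety.fst A B ≫ φ) (AbelianVariety.snd A B ≫ (-ψ))) (n + n)
      ((d : ℂ) • complexBetti.map e.ι 2 a +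
        complexBetti.map (AbelianVariety.prodLift (AbelianVariety.fst A B ≫ φ)
          (AbelianVariety.snd A B ≫ (-ψ))).hom.hom.hom 2 (complexBetti.map e.ι 2 a))) :
    δA = δB := by
  have hψ' : (-ψ) ≫ (-ψ) = -(d • 𝟙 B) := by rw [Preadditive.neg_comp, Preadditive.comp_neg, neg_neg, hψ]
  have hΦ := prodLift_comp_self_eq_neg_nsmul hφ hψ'
  have hdim : (A.prod B).dim = 2 * (n + n) := by rw [AbelianVariety.dim_prod, hA, hB]; ring
  have hnn : 0 < n + n := by omega
  have h1 := hasWeilDiscriminantNondeg_twistedProd_segre hn hd hA hB hφ hψ eA haA eB haB hWA hWB e ha ha0 hc0 he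
  have h2 := hasWeilDiscriminantNondeg_neg_one_pow_of_isHyperbolicWeilType hnn hdim hd hΦ e ha ha0 hhyp
  have h12 : δA * δB = QuotientGroup.mk ((-1 : ℚˣ) ^ (n + n)) :=
    hasWeilDiscriminantNondeg_ksymm_unique hnn hdim hd hΦ e ha h1 h2
  refine eq_of_mul_eq_one_weilNormResidueGroup ?_
  rw [h12, ← splitDiscriminantClass_add_self n d]

/-- **HYPERBOLIC AT THE SEGRE CLASS ⟺ ISODISCRIMINANTAL**, for `(A, φ)`, `(B, ψ)` of Weil type `(n, n)`: ⟹ is the previous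
theorem; ⟸: with `δ_A = δ_B` the Segre class of the twisted product carries `δ · δ = 1 = [(−1)^{2n}]` (§1) and the twisted
product is of Weil type `(2n, 2n)` (`isWeilType_twistedProd`), so Landherr's converse on the carriers
(`VanGeemen1994.isHyperbolicWeilType_of_hasWeilDiscriminantNondeg_split`, the Weil class supplied by the Weil type) makes it
hyperbolic AT THAT CLASS. So «isodiscriminantal» is exactly «the product polarisation of `X_s × X̄_t` is hyperbolic».
[cite: vanGeemen1994HodgeAV, 4.9, Lemma 5.2 (3), 5.4 and (5.4.1)] [cite: Landherr1936HermitianForms] -/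
theorem isHyperbolicWeilType_twistedProd_segre_iff_class_eq (hWtA : IsWeilType A φ n d) (hWtB : IsWeilType B ψ n d)
    (eA : ProjectiveEmbedding A.X) {aA : complexBetti (projectiveSpace eA.n ℂ) 2} (haA : IsRationalClass aA)
    (eB : ProjectiveEmbedding B.X) {aB : complexBetti (projectiveSpace eB.n ℂ) 2} (haB : IsRationalClass aB)
    {δA δB : weilNormResidueGroup d}
    (hWA : HasWeilDiscriminantNondeg A φ n d
      ((d : ℂ) • complexBetti.map eA.ι 2 aA + complexBetti.map φ.hom.hom.hom 2 (complexBetti.map eA.ι 2 aA)) δA)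
    (hWB : HasWeilDiscriminantNondeg B ψ n d
      ((d : ℂ) • complexBetti.map eB.ι 2 aB + complexBetti.map ψ.hom.hom.hom 2 (complexBetti.map eB.ι 2 aB)) δB)
    (e : ProjectiveEmbedding (A.prod B).X) {a : complexBetti (projectiveSpace e.n ℂ) 2} (ha : IsRationalClass a)
    (ha0 : a ≠ 0) {c : ℚ} (hc0 : c ≠ 0)
    (he : complexBetti.map e.ι 2 a =
      complexBetti.map (AbelianVariety.fst A B).hom.hom.hom 2 (complexBetti.map eA.ι 2 aA) +
        ((c : ℚ) : ℂ) • complexBetti.map (AbelianVariety.snd A B).hom.hom.hom 2 (complexBetti.map eB.ι 2 aB)) :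
    IsHyperbolicWeilType (A.prod B)
        (AbelianVariety.prodLift (AbelianVariety.fst A B ≫ φ) (AbelianVariety.snd A B ≫ (-ψ))) (n + n)
        ((d : ℂ) • complexBetti.map e.ι 2 a +
          complexBetti.map (AbelianVariety.prodLift (AbelianVariety.fst A B ≫ φ)
            (AbelianVariety.snd A B ≫ (-ψ))).hom.hom.hom 2 (complexBetti.map e.ι 2 a)) ↔
      δA = δB := by
  refine ⟨class_eq_of_isHyperbolicWeilType_twistedProd_segre hWtA.pos hWtA.d_pos hWtA.dim_eq hWtB.dim_eq hWtA.sq_eq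
    hWtB.sq_eq eA haA eB haB hWA hWB e ha ha0 hc0 he, fun hδ ↦ ?_⟩
  subst hδ
  have hWP : IsWeilType (A.prod B)
      (AbelianVariety.prodLift (AbelianVariety.fst A B ≫ φ) (AbelianVariety.snd A B ≫ (-ψ))) (n + n) d :=
    isWeilType_twistedProd hWtA hWtB
  have h1 := hasWeilDiscriminantNondeg_twistedProd_segre hWtA.pos hWtA.d_pos hWtA.dim_eq hWtB.dim_eq hWtA.sq_eq
    hWtB.sq_eq eA haA eB haB hWA hWB e ha ha0 hc0 he
  have hcl : δA * δA = QuotientGroup.mk ((-1 : ℚˣ) ^ (n + n)) := by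
    rw [weilNormResidueGroup_mul_self, ← splitDiscriminantClass_add_self n d]
  rw [hcl] at h1
  obtain ⟨w, hw, hw0, hwr⟩ := exists_isRationalClass_ne_zero_mem_weilClassesOf hWP.pos hWP.dim_eq hWP.d_pos hWP.sq_eq
  exact isHyperbolicWeilType_of_hasWeilDiscriminantNondeg_split hWP.pos hWP.dim_eq hWP.d_pos hWP.sq_eq e ha ha0
    ⟨w, hw, hwr, hWP.isOfHodgeType_of_mem_weilClassesOf hw, hw0⟩ h1

end Summit.HodgeConjecture.HodgeConjecture.Ring2.AbelianAll

end
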